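import Mathlib
import Summits.NavierStokesRegularity.NavierStokesRegularity.Theorems.ThreadingFluxHorizonTowerFourthDigitBrackets
import HarnessLib

/-!
# Crux `PoloidalLiouville` (stmt-NavierStokesRegularity-1222), crux idea «horizon-threading-tower» (ns-idea-15):
# THE FOURTH CONE DIGIT, III — the competitor-against-top bracket `{P_c′, G₂}` to SECOND order in `ρ`

Support file (`--supports stmt-NavierStokesRegularity-1222`, helper; cell `ns-wall-extremal`, width hand ns-wall-eng-3 g7; 0 kit), toward
THM K (`FiniteTowerGcdTwoTwoShellsHorizonTowerZonality`); continuation of `…FourthDigitBrackets` (split for the 400-line cap).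
★ `exists_detP_competitor_remainder₂`: for the confined harmonic competitor `P_c′ = κ₀L^{k+3} + κ₁L^{k+2}M + ρG_c` and a top remainder
`(8n+14)G₂ = A₂L^nM − ρΔG₂`: `q₂f₂d₁·L³{P_c′,G₂} = X₀ + ρX₁ + ρ²J` with `X₀, X₁` explicit (statement checked by the seat's exact CAS).

HONEST LABEL: polynomial algebra about one crux idea's typed objects; no Prop of the sketch is closed here; `HorizonTowerZonality`
(general towers), `PoloidalLiouville` (1222) OPEN; NS regularity NOT proved.  [folklore]
-/

-- the summit and its single sub-problem share the name (CONVENTIONS §1)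
set_option linter.dupNamespace false
-- `simp only` closers over `C`-coefficients are import-order sensitive (simprocs); keep the lists explicit, silence the arg linter
set_option linter.unusedSimpArgs false

noncomputable section

open MvPolynomial

namespace Summit.NavierStokesRegularity.NavierStokesRegularity.Theorems.PoloidalLiouville.HorizonTower.Zonal

section Real

variable (a b d e f : ℝ)

/-- ★ `{P_c′, G₂}` to SECOND order for the confined harmonic competitor `P_c′ = κ₀L^{k+3} + κ₁L^{k+2}M + ρG_c` and a top remainder
`(8n+14)G₂ = A₂L^nM − ρΔG₂` (`n ≥ 1`; `q₂ = 8n+14`, `f₂ = 16n+20`, `d₁ = 8k+22`; `m = k+2`):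
`q₂f₂d₁·L³{P_c′,G₂} = d₁f₂A₂(4(k+3)κ₀L^{k+n+5} + 4(k+2−n)κ₁L^{k+n+4}M)W − ρ·(d₁A₂(32n(n−1)(k+3)κ₀L^{k+n+3}M`
`+ κ₁(−4n(4n+2)τL^{k+n+4} + 16n(n−1)(2k−n+6)L^{k+n+2}M²)) + f₂A₂(16(k+3)(k+2)(k+1−n)κ₀L^{k+n+3}M`
`+ κ₁(4(k+2)(4k+10)τL^{k+n+4} − 16(k+2)(k+1)(2n−k)L^{k+n+2}M²)))W + ρ²J`. [folklore] -/
theorem exists_detP_competitor_remainder₂ {Pc Gc G₂ : RPoly} {κ₀ κ₁ A₂ : ℝ} {k n : ℕ}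
    (hGc : Gc.IsHomogeneous (2 * k + 4)) (hG₂ : G₂.IsHomogeneous (2 * n + 2))
    (hPc : Pc = C κ₀ * genL a b d e f ^ (k + 3) + C κ₁ * genL a b d e f ^ (k + 2) * genM a b d e f + normSq * Gc) (hl : lapP Pc = 0)
    (h₂ : C (8 * (n : ℝ) + 14) * G₂ = C A₂ * genL a b d e f ^ n * genM a b d e f - normSq * lapP G₂) :
    ∃ J : RPoly, C ((8 * (n : ℝ) + 14) * (16 * (n : ℝ) + 20) * (8 * (k : ℝ) + 22)) * (genL a b d e f ^ 3 * detP Pc G₂)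
      = (8 * (k : RPoly) + 22) * (16 * (n : RPoly) + 20) * C A₂
          * (C (4 * ((k : ℝ) + 3) * κ₀) * genL a b d e f ^ (k + n + 5) * genW a b d e f + C (4 * ((k : ℝ) + 2 - n) * κ₁) * genL a b d e f ^ (k + n + 4) * genM a b d e f * genW a b d e f)
        - normSq * ((8 * (k : RPoly) + 22) * C A₂ * (C (32 * (n : ℝ) * ((n : ℝ) - 1) * ((k : ℝ) + 3) * κ₀) * genL a b d e f ^ (k + n + 3) * genM a b d e f
              + C κ₁ * (-(C (4 * (n : ℝ) * (4 * (n : ℝ) + 2) * genTau a b d e f)) * genL a b d e f ^ (k + n + 4)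
                + C (16 * (n : ℝ) * ((n : ℝ) - 1) * (2 * (k : ℝ) - n + 6)) * genL a b d e f ^ (k + n + 2) * genM a b d e f ^ 2))
            + (16 * (n : RPoly) + 20) * C A₂ * (C (16 * ((k : ℝ) + 3) * ((k : ℝ) + 2) * ((k : ℝ) + 1 - n) * κ₀) * genL a b d e f ^ (k + n + 3) * genM a b d e f
              + C κ₁ * (C (4 * ((k : ℝ) + 2) * (4 * (k : ℝ) + 10) * genTau a b d e f) * genL a b d e f ^ (k + n + 4)
                - C (16 * ((k : ℝ) + 2) * ((k : ℝ) + 1) * (2 * (n : ℝ) - k)) * genL a b d e f ^ (k + n + 2) * genM a b d e f ^ 2))) * genW a b d e f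
        + normSq ^ 2 * J := by
  -- (1) `G₂` to two orders
  have f₂ := lapP_remainder a b d e f hG₂ h₂
  have hG : C ((8 * (n : ℝ) + 14) * (16 * (n : ℝ) + 20)) * G₂ = C ((16 * (n : ℝ) + 20) * A₂) * (genL a b d e f ^ n * genM a b d e f)
      - normSq * (C A₂ * lapP (genL a b d e f ^ n * genM a b d e f)) + normSq * (normSq * lapP (lapP G₂)) := by
    simp only [map_mul, map_add, map_natCast, map_ofNat] at h₂ f₂ ⊢
    linear_combination (16 * (n : RPoly) + 20) * h₂ - normSq * f₂
  -- (2) `{P_c′, q₂f₂G₂}`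
  have e0 := congrArg (detP Pc) hG
  rw [detP_C_mul_right, detP_add_right, detP_sub_right, detP_C_mul_right, detP_normSq_mul_right', detP_C_mul_right,
    detP_normSq_mul_right', detP_normSq_mul_right'] at e0
  -- (3) `{P_c′, X}` split through `P_c′ = κ₀L^{k+3} + κ₁L^{k+2}M + ρG_c`
  have hPc' : Pc = C κ₀ * genL a b d e f ^ (k + 3) + C κ₁ * (genL a b d e f ^ (k + 2) * genM a b d e f) + normSq * Gc := by rw [hPc]; ring
  have split : ∀ X : RPoly, detP Pc X = C κ₀ * detP (genL a b d e f ^ (k + 3)) X + C κ₁ * detP (genL a b d e f ^ (k + 2) * genM a b d e f) X + normSq * detP Gc X := by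
    intro X; rw [hPc', detP_add_left, detP_add_left, detP_C_mul_left, detP_C_mul_left, detP_normSq_mul_left']
  have sX := split (genL a b d e f ^ n * genM a b d e f)
  have sY := split (lapP (genL a b d e f ^ n * genM a b d e f))
  -- explicit brackets with `X_n = L^nM`
  have e1 := detP_genL_pow_succ_genL_pow_mul_genM a b d e f (k + 2) n          -- {L^{k+3}, L^nM}
  rw [show k + 2 + 1 = k + 3 from rfl] at e1
  have e2 := genL_sq_mul_detP_genL_pow_mul_genM a b d e f (k + 2) n           -- L²{L^{k+2}M, L^nM}
  -- `{G_c, X_n}` to first order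
  have r1 := competitor_remainder a b d e f hGc hPc hl
  have g1 := congrArg (fun Z => detP Z (genL a b d e f ^ n * genM a b d e f)) r1
  simp only [detP_sub_left, detP_neg_left, detP_C_mul_left, detP_normSq_mul_left'] at g1
  have s1 : detP (lapP (genL a b d e f ^ (k + 3))) (genL a b d e f ^ n * genM a b d e f)
      = C (4 * ((k : ℝ) + 3) * ((k : ℝ) + 2)) * detP (genL a b d e f ^ (k + 1) * genM a b d e f) (genL a b d e f ^ n * genM a b d e f) := by
    rw [show k + 3 = k + 1 + 2 from rfl, lapP_genL_pow, mul_assoc, detP_C_mul_left]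
    simp only [Nat.cast_add, Nat.cast_one, map_mul, map_add, map_natCast, map_ofNat, map_one]; ring
  have s2 := genL_sq_mul_detP_genL_pow_mul_genM a b d e f (k + 1) n           -- L²{L^{k+1}M, L^nM}
  have Rk := genL_sq_mul_lapP_genL_pow_mul_genM a b d e f (k + 2)              -- L²Δ(L^{k+2}M)
  have c2 := genL_cube_mul_detP_of_sq_mul a b d e f (genL a b d e f ^ n * genM a b d e f) _ _ Rk       -- L³{X_n, Δ(L^{k+2}M)}
  rw [detP_genL_pow_mul_genM_genL] at c2
  have d2 : genL a b d e f * detP (genL a b d e f ^ n * genM a b d e f) (C ((4 * ((k + 2 : ℕ) : ℝ) + 2) * genTau a b d e f) * genL a b d e f ^ (k + 2 + 2)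
      + C (4 * ((k + 2 : ℕ) : ℝ) * (((k + 2 : ℕ) : ℝ) - 1)) * genL a b d e f ^ (k + 2) * genM a b d e f ^ 2
      + C (8 * ((k + 2 : ℕ) : ℝ) * genDelta a b d e f) * normSq * genL a b d e f ^ (k + 2 + 1))
      = C ((4 * ((k + 2 : ℕ) : ℝ) + 2) * genTau a b d e f) * (genL a b d e f * detP (genL a b d e f ^ n * genM a b d e f ^ (0 + 1)) (genL a b d e f ^ (k + 2 + 2)))
        + C (4 * ((k + 2 : ℕ) : ℝ) * (((k + 2 : ℕ) : ℝ) - 1)) * (genL a b d e f * detP (genL a b d e f ^ n * genM a b d e f ^ (0 + 1)) (genL a b d e f ^ (k + 2) * genM a b d e f ^ (1 + 1)))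
        + C (8 * ((k + 2 : ℕ) : ℝ) * genDelta a b d e f) * normSq * (genL a b d e f * detP (genL a b d e f ^ n * genM a b d e f ^ (0 + 1)) (genL a b d e f ^ (k + 2 + 1))) := by
    rw [show C (4 * ((k + 2 : ℕ) : ℝ) * (((k + 2 : ℕ) : ℝ) - 1)) * genL a b d e f ^ (k + 2) * genM a b d e f ^ 2
        = C (4 * ((k + 2 : ℕ) : ℝ) * (((k + 2 : ℕ) : ℝ) - 1)) * (genL a b d e f ^ (k + 2) * genM a b d e f ^ (1 + 1)) by ring,
      show C (8 * ((k + 2 : ℕ) : ℝ) * genDelta a b d e f) * normSq * genL a b d e f ^ (k + 2 + 1) = C (8 * ((k + 2 : ℕ) : ℝ) * genDelta a b d e f) * (normSq * genL a b d e f ^ (k + 2 + 1)) by ring,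
      detP_add_right, detP_add_right, detP_C_mul_right, detP_C_mul_right, detP_C_mul_right, detP_normSq_mul_right', zero_add, pow_one]
    ring
  rw [genL_mul_detP_genL_pow_mul_genM_pow_genL_pow, genL_mul_detP_genL_pow_mul_genM_pow, genL_mul_detP_genL_pow_mul_genM_pow_genL_pow] at d2
  rw [d2] at c2
  rw [detP_antisymm (genL a b d e f ^ n * genM a b d e f) (lapP (genL a b d e f ^ (k + 2) * genM a b d e f))] at g1
  -- (4) explicit brackets with `Y_n = Δ(L^nM)` through `L²Y_n = R_n`
  have Rn := genL_sq_mul_lapP_genL_pow_mul_genM a b d e f n                    -- L²Δ(L^nM)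
  have c0 := genL_cube_mul_detP_of_sq_mul a b d e f (genL a b d e f ^ (k + 3)) _ _ Rn       -- L³{L^{k+3}, Y_n}
  have c1 := genL_cube_mul_detP_of_sq_mul a b d e f (genL a b d e f ^ (k + 2) * genM a b d e f) _ _ Rn   -- L³{L^{k+2}M, Y_n}
  rw [detP_genL_pow_genL] at c0
  rw [detP_genL_pow_mul_genM_genL] at c1
  have d0 : genL a b d e f * detP (genL a b d e f ^ (k + 3)) (C ((4 * (n : ℝ) + 2) * genTau a b d e f) * genL a b d e f ^ (n + 2) + C (4 * (n : ℝ) * ((n : ℝ) - 1)) * genL a b d e f ^ n * genM a b d e f ^ 2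
      + C (8 * (n : ℝ) * genDelta a b d e f) * normSq * genL a b d e f ^ (n + 1))
      = C (4 * (n : ℝ) * ((n : ℝ) - 1)) * (genL a b d e f * detP (genL a b d e f ^ (k + 3)) (genL a b d e f ^ n * genM a b d e f ^ (1 + 1))) := by
    rw [show C (4 * (n : ℝ) * ((n : ℝ) - 1)) * genL a b d e f ^ n * genM a b d e f ^ 2 = C (4 * (n : ℝ) * ((n : ℝ) - 1)) * (genL a b d e f ^ n * genM a b d e f ^ (1 + 1)) by ring,
      show C (8 * (n : ℝ) * genDelta a b d e f) * normSq * genL a b d e f ^ (n + 1) = C (8 * (n : ℝ) * genDelta a b d e f) * (normSq * genL a b d e f ^ (n + 1)) by ring,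
      detP_add_right, detP_add_right, detP_C_mul_right, detP_C_mul_right, detP_C_mul_right, detP_normSq_mul_right']
    have z1 : detP (genL a b d e f ^ (k + 3)) (genL a b d e f ^ (n + 2)) = 0 := by
      rw [detP_pow_right, detP_antisymm (genL a b d e f) (genL a b d e f ^ (k + 3)), detP_pow_self, neg_zero, mul_zero]
    have z2 : detP (genL a b d e f ^ (k + 3)) (genL a b d e f ^ (n + 1)) = 0 := by
      rw [detP_pow_right, detP_antisymm (genL a b d e f) (genL a b d e f ^ (k + 3)), detP_pow_self, neg_zero, mul_zero]
    rw [z1, z2]; ring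
  rw [genL_mul_detP_genL_pow_genL_pow_mul_genM_pow] at d0
  have d1 : genL a b d e f * detP (genL a b d e f ^ (k + 2) * genM a b d e f) (C ((4 * (n : ℝ) + 2) * genTau a b d e f) * genL a b d e f ^ (n + 2) + C (4 * (n : ℝ) * ((n : ℝ) - 1)) * genL a b d e f ^ n * genM a b d e f ^ 2
      + C (8 * (n : ℝ) * genDelta a b d e f) * normSq * genL a b d e f ^ (n + 1))
      = C ((4 * (n : ℝ) + 2) * genTau a b d e f) * (genL a b d e f * detP (genL a b d e f ^ (k + 2) * genM a b d e f ^ (0 + 1)) (genL a b d e f ^ (n + 2)))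
        + C (4 * (n : ℝ) * ((n : ℝ) - 1)) * (genL a b d e f * detP (genL a b d e f ^ (k + 2) * genM a b d e f ^ (0 + 1)) (genL a b d e f ^ n * genM a b d e f ^ (1 + 1)))
        + C (8 * (n : ℝ) * genDelta a b d e f) * normSq * (genL a b d e f * detP (genL a b d e f ^ (k + 2) * genM a b d e f ^ (0 + 1)) (genL a b d e f ^ (n + 1))) := by
    rw [show C (4 * (n : ℝ) * ((n : ℝ) - 1)) * genL a b d e f ^ n * genM a b d e f ^ 2 = C (4 * (n : ℝ) * ((n : ℝ) - 1)) * (genL a b d e f ^ n * genM a b d e f ^ (1 + 1)) by ring,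
      show C (8 * (n : ℝ) * genDelta a b d e f) * normSq * genL a b d e f ^ (n + 1) = C (8 * (n : ℝ) * genDelta a b d e f) * (normSq * genL a b d e f ^ (n + 1)) by ring,
      detP_add_right, detP_add_right, detP_C_mul_right, detP_C_mul_right, detP_C_mul_right, detP_normSq_mul_right', zero_add, pow_one]
    ring
  rw [genL_mul_detP_genL_pow_mul_genM_pow_genL_pow, genL_mul_detP_genL_pow_mul_genM_pow, genL_mul_detP_genL_pow_mul_genM_pow_genL_pow] at d1
  rw [d0] at c0
  rw [d1] at c1
  refine ⟨(8 * (k : RPoly) + 22) * genL a b d e f ^ 3 * detP Pc (lapP (lapP G₂))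
      - (16 * (n : RPoly) + 20) * C A₂ * genL a b d e f ^ 3 * detP (lapP Gc) (genL a b d e f ^ n * genM a b d e f)
      - (8 * (k : RPoly) + 22) * C A₂ * genL a b d e f ^ 3 * detP Gc (lapP (genL a b d e f ^ n * genM a b d e f))
      + C A₂ * C κ₁ * C (genDelta a b d e f) * (32 * (n : RPoly) * ((n : RPoly) - 1) * (8 * (k : RPoly) + 22)
          - 32 * ((k : RPoly) + 2) * ((k : RPoly) + 1) * (16 * (n : RPoly) + 20)) * genL a b d e f ^ (k + n + 3) * genW a b d e f, ?_⟩
  simp only [map_mul, map_add, map_sub, map_neg, map_natCast, map_ofNat, map_one, Nat.cast_add, Nat.cast_ofNat, Nat.cast_one, zero_add,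
    pow_one, pow_zero, mul_one] at e0 sX sY e1 e2 g1 s1 s2 c2 c0 c1
  simp only [map_mul, map_add, map_sub, map_neg, map_natCast, map_ofNat, map_one, Nat.cast_add, Nat.cast_ofNat, Nat.cast_one]
  linear_combination ((8 * (k : RPoly) + 22) * genL a b d e f ^ 3) * e0
    + ((8 * (k : RPoly) + 22) * (16 * (n : RPoly) + 20) * C A₂ * genL a b d e f ^ 3) * sX
    - (normSq * (8 * (k : RPoly) + 22) * C A₂ * genL a b d e f ^ 3) * sY
    + ((8 * (k : RPoly) + 22) * (16 * (n : RPoly) + 20) * C A₂ * C κ₀ * genL a b d e f ^ 3) * e1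
    + ((8 * (k : RPoly) + 22) * (16 * (n : RPoly) + 20) * C A₂ * C κ₁ * genL a b d e f) * e2
    + ((16 * (n : RPoly) + 20) * C A₂ * normSq * genL a b d e f ^ 3) * g1
    - ((16 * (n : RPoly) + 20) * C A₂ * normSq * C κ₀ * genL a b d e f ^ 3) * s1
    - ((16 * (n : RPoly) + 20) * C A₂ * normSq * C κ₀ * (4 * ((k : RPoly) + 3) * ((k : RPoly) + 2)) * genL a b d e f) * s2
    + ((16 * (n : RPoly) + 20) * C A₂ * normSq * C κ₁) * c2
    - (normSq * (8 * (k : RPoly) + 22) * C A₂ * C κ₀) * c0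
    - (normSq * (8 * (k : RPoly) + 22) * C A₂ * C κ₁) * c1

end Real

end Summit.NavierStokesRegularity.NavierStokesRegularity.Theorems.PoloidalLiouville.HorizonTower.Zonal

end
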